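import Literature.MathematicalPhysics.QuantumFieldTheory.Multiboson

/-!
# The bosonised gap hypothesis of `GapTransferR3` is UNIFORM-constant clustering

Crux-strategist artefact for `stmt-QuantumFields-11439`
(`Summit.QuantumFields.QCD.Theses.MultibosonBridge.GapTransferR3`, route `MultibosonBridge`).

`QCDScheme.HasMultibosonLatticeGap sch ν Δ` quantifies over `k`-INDEXED FAMILIES `A, A'` of bounded
measurable cylinder gauge functionals of bounded PHYSICAL radius (`a_k r_k ≤ ρ`) and grants one
constant `C` per pair of families, eventually in `k`. Two seats recorded the folklore that such
"per-pair constants" make the hypothesis unusable as the input of any soft transfer (line card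
`Cruxes/FullLatticeGapC/Lines/multiboson_split.md`, "Known typing weakness"; registrar note on
`Cruxes/FullLatticeGap/Lines/birth.lean`). For THIS predicate that is not so: a worst-family
(diagonal) argument shows it is EQUIVALENT to clustering with ONE constant for ALL test functionals
of the given radius profile simultaneously — `hasMultibosonLatticeGap_uniform` /
`hasMultibosonLatticeGap_iff_uniform` below (sorry-free). The QCD-side `QCDScheme.HasLatticeMassGap`
quantifies over FIXED observables `A, B` and is genuinely per-pair; the asymmetry matters for the
typing of the T1/T2 interface of the registered line `birth_GapTransferR3.lean`.

Proof idea: if no uniform constant works, then for every `n : ℕ` there are, frequently in `k`,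
violating data `(S, t, F, G)` with constant `n`; pick at each `k` violators for the LARGEST `n ≤ k`
that admits any (`Nat.findGreatest`), assemble them into ONE pair of admissible families, and apply
the hypothesis to that pair: its constant `C` is beaten at every late `k` at which constant `⌈C⌉₊`
is violated — contradiction.
-/

open MeasureTheory Filter Topology
open Literature.Probability.LatticeModels Literature.MathematicalPhysics.QuantumLattice

noncomputable section

namespace Summit.QuantumFields.QCD.Cruxes.GapTransferR3.Uniform

open Literature.MathematicalPhysics.QuantumFieldTheory

local notation "𝔾" => Matrix.specialUnitaryGroup (Fin 3) ℂ

variable {Nf : ℕ}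

/-- A test functional of the bosonised gap predicate at radius `r`: measurable, bounded by `1`,
cylinder of a finite edge set within `ℓ^∞`-radius `r` of the origin — VERBATIM the per-`k` clause of
`QCDScheme.HasMultibosonLatticeGap`. [folklore] -/
def IsGapTest (r : ℕ) (O : LGConfig 4 𝔾 → ℂ) : Prop :=
  Measurable O ∧ (∀ U, ‖O U‖ ≤ 1) ∧
    ∃ es : Finset (Literature.MathematicalPhysics.QuantumLattice.ZdEdge 4), IsCylinder O es ∧ ∀ e ∈ es, ∀ j, |e.1 j| ≤ r

/-- The zero functional is a test functional at every radius. [folklore] -/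
theorem isGapTest_zero (r : ℕ) : IsGapTest r (fun _ : LGConfig 4 𝔾 => (0 : ℂ)) := by
  refine ⟨measurable_const, fun _ => by simp, ∅, ?_, fun e he => by simp at he⟩
  intro _ _ _
  rfl

/-- The connected two-point quantity bounded by `QCDScheme.HasMultibosonLatticeGap`: at level `k`, on
the torus of side `2S+1`, the bosonised covariance of `F` placed at time `0` and `G` placed at time
`t` — VERBATIM the `let plc / let Ek` body of the predicate. [folklore] -/
def mbCov (sch : QCDScheme Nf) (ν : ℕ → Fin Nf → List ℂ) (k S t : ℕ)
    (F G : LGConfig 4 𝔾 → ℂ) : ℂ :=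
  let plc := fun (O : LGConfig 4 𝔾 → ℂ) (s : ℕ) (U : GaugeConfig 4 (2 * S + 1) 𝔾) =>
    O (configShift (-(Pi.single 0 (s : ℤ) : Fin 4 → ℤ)) (torusLift (2 * S + 1) U))
  let Ek := multibosonExpect (2 * S + 1) (sch.β k) (fun f => sch.mq f k) (ν k)
  Ek (fun U => plc F 0 U * plc G t U) - Ek (plc F 0) * Ek (plc G t)

/-- `HasMultibosonLatticeGap` unfolded through `IsGapTest` / `mbCov` (definitional). [folklore] -/
theorem hasMultibosonLatticeGap_iff_families (sch : QCDScheme Nf) (ν : ℕ → Fin Nf → List ℂ)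
    (Δ : ℝ) :
    sch.HasMultibosonLatticeGap ν Δ ↔
      ∀ (A A' : ℕ → LGConfig 4 𝔾 → ℂ) (r : ℕ → ℕ), (∃ ρ : ℝ, ∀ k, sch.a k * r k ≤ ρ) →
        (∀ k, IsGapTest (r k) (A k)) → (∀ k, IsGapTest (r k) (A' k)) →
        ∃ C : ℝ, ∀ᶠ k in atTop, ∀ S : ℕ, sch.L k ≤ S → ∀ t : ℕ, t ≤ S →
          ‖mbCov sch ν k S t (A k) (A' k)‖ ≤ C * Real.exp (-(Δ * (sch.a k * t))) := by
  unfold QCDScheme.HasMultibosonLatticeGap IsGapTest mbCov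
  constructor
  · intro h A A' r hr hA hA'
    exact h A A' r hr (fun O hO k => by
      simp only [List.mem_cons, List.not_mem_nil, or_false] at hO
      rcases hO with rfl | rfl
      · exact hA k
      · exact hA' k)
  · intro h A A' r hr hO
    exact h A A' r hr (fun k => hO A (by simp) k) (fun k => hO A' (by simp) k)

/-- **Uniformisation (worst-family argument).** A bosonised lattice gap `Δ` in the sense of
`QCDScheme.HasMultibosonLatticeGap` yields, for every radius profile `r` of bounded physical range,
ONE constant `C` such that eventually in `k`, on every torus of side `2S+1 ≥ 2L_k+1`, for all times
`t ≤ S` and ALL pairs of test functionals `F, G` at radius `r_k`: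
`‖Cov^bos_{k,S}(F, τ_t G)‖ ≤ C e^{−Δ a_k t}`. [folklore] -/
theorem hasMultibosonLatticeGap_uniform {sch : QCDScheme Nf} {ν : ℕ → Fin Nf → List ℂ}
    {Δ : ℝ} (h : sch.HasMultibosonLatticeGap ν Δ) (r : ℕ → ℕ)
    (hr : ∃ ρ : ℝ, ∀ k, sch.a k * r k ≤ ρ) :
    ∃ C : ℝ, ∀ᶠ k in atTop, ∀ S : ℕ, sch.L k ≤ S → ∀ t : ℕ, t ≤ S →
      ∀ F G : LGConfig 4 𝔾 → ℂ, IsGapTest (r k) F → IsGapTest (r k) G →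
        ‖mbCov sch ν k S t F G‖ ≤ C * Real.exp (-(Δ * (sch.a k * t))) := by
  classical
  rw [hasMultibosonLatticeGap_iff_families] at h
  by_contra hcon
  -- `bad n k`: at level `k` some admissible data violate the bound with constant `n`
  set bad : ℕ → ℕ → Prop := fun n k => ∃ S : ℕ, sch.L k ≤ S ∧ ∃ t : ℕ, t ≤ S ∧
      ∃ F G : LGConfig 4 𝔾 → ℂ, IsGapTest (r k) F ∧ IsGapTest (r k) G ∧
        (n : ℝ) * Real.exp (-(Δ * (sch.a k * t))) < ‖mbCov sch ν k S t F G‖ with hbad_def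
  have hfreq : ∀ n : ℕ, ∃ᶠ k in atTop, bad n k := by
    intro n
    by_contra hno
    rw [Filter.not_frequently] at hno
    apply hcon
    refine ⟨n, hno.mono fun k hk S hS t ht F G hF hG => ?_⟩
    by_contra hlt
    push Not at hlt
    exact hk ⟨S, hS, t, ht, F, G, hF, hG, hlt⟩
  -- the largest violated constant `≤ k` at level `k`
  set nk : ℕ → ℕ := fun k => Nat.findGreatest (fun n => bad n k) k with hnk_def
  -- witnesses: violators for `nk k` when there are any, the zero functionals otherwise
  have hw : ∀ k, ∃ (S t : ℕ) (F G : LGConfig 4 𝔾 → ℂ), IsGapTest (r k) F ∧ IsGapTest (r k) G ∧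
      (bad (nk k) k → sch.L k ≤ S ∧ t ≤ S ∧
        ((nk k : ℕ) : ℝ) * Real.exp (-(Δ * (sch.a k * t))) < ‖mbCov sch ν k S t F G‖) := by
    intro k
    by_cases hb : bad (nk k) k
    · obtain ⟨S, hS, t, ht, F, G, hF, hG, hlt⟩ := hb
      exact ⟨S, t, F, G, hF, hG, fun _ => ⟨hS, ht, hlt⟩⟩
    · exact ⟨0, 0, fun _ => 0, fun _ => 0, isGapTest_zero _, isGapTest_zero _,
        fun hb' => absurd hb' hb⟩
  choose S t F G hF hG hviol using hw
  -- apply the hypothesis to the worst families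
  obtain ⟨C, hC⟩ := h F G r hr hF hG
  -- a natural number above `C`
  obtain ⟨c, hc⟩ := exists_nat_ge C
  -- late `k` with `bad c k`, `k ≥ c`, and the bound in force
  have hev : ∀ᶠ k in atTop, (∀ S : ℕ, sch.L k ≤ S → ∀ t : ℕ, t ≤ S →
      ‖mbCov sch ν k S t (F k) (G k)‖ ≤ C * Real.exp (-(Δ * (sch.a k * t)))) ∧ c ≤ k :=
    hC.and (eventually_ge_atTop c)
  obtain ⟨k, hbadk, hbound, hck⟩ := ((hfreq c).and_eventually hev).exists
  -- `nk k ≥ c` and `bad (nk k) k`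
  have hnk_ge : c ≤ nk k := Nat.le_findGreatest hck hbadk
  have hnk_bad : bad (nk k) k := by
    have := Nat.findGreatest_spec (P := fun n => bad n k) hck hbadk
    simpa [hnk_def] using this
  obtain ⟨hS, ht, hlt⟩ := hviol k hnk_bad
  have h1 := hbound (S k) hS (t k) ht
  have hexp : 0 ≤ Real.exp (-(Δ * (sch.a k * t k))) := (Real.exp_pos _).le
  have h2 : C * Real.exp (-(Δ * (sch.a k * t k))) ≤
      ((nk k : ℕ) : ℝ) * Real.exp (-(Δ * (sch.a k * t k))) := by
    apply mul_le_mul_of_nonneg_right _ hexp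
    exact hc.trans (by exact_mod_cast hnk_ge)
  exact absurd (h1.trans h2) (not_le.mpr hlt)

/-- **Equivalence.** `HasMultibosonLatticeGap` is EQUIVALENT to its uniform-constant form (one `C`
per radius profile, all test functionals at once). [folklore] -/
theorem hasMultibosonLatticeGap_iff_uniform (sch : QCDScheme Nf) (ν : ℕ → Fin Nf → List ℂ)
    (Δ : ℝ) :
    sch.HasMultibosonLatticeGap ν Δ ↔
      ∀ r : ℕ → ℕ, (∃ ρ : ℝ, ∀ k, sch.a k * r k ≤ ρ) →
        ∃ C : ℝ, ∀ᶠ k in atTop, ∀ S : ℕ, sch.L k ≤ S → ∀ t : ℕ, t ≤ S →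
          ∀ F G : LGConfig 4 𝔾 → ℂ, IsGapTest (r k) F → IsGapTest (r k) G →
            ‖mbCov sch ν k S t F G‖ ≤ C * Real.exp (-(Δ * (sch.a k * t))) := by
  constructor
  · intro h r hr
    exact hasMultibosonLatticeGap_uniform h r hr
  · intro h
    rw [hasMultibosonLatticeGap_iff_families]
    intro A A' r hr hA hA'
    obtain ⟨C, hC⟩ := h r hr
    exact ⟨C, hC.mono fun k hk S hS t ht => hk S hS t ht (A k) (A' k) (hA k) (hA' k)⟩

end Summit.QuantumFields.QCD.Cruxes.GapTransferR3.Uniform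

end
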